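import Summits.Ventures.LatticeQCDFlow.Scaling.ExtensiveSpecificHeatHeatBath

/-!
HONEST FRAMING: exact (Metropolis-corrected) sampling algorithms for lattice gauge theory; figures
of merit are autocorrelation/cost numbers at stated couplings and volumes; no continuum-physics
claim.

# TiltedHeatBath — THE ONE-LINK HEAT-BATH OPERATOR OF A TILTED PRODUCT-HAAR MEASURE FOR AN
# ARBITRARY CONTINUOUS LOG-DENSITY `Φ`; INNOVATIONS, FIBRE VARIANCES, WEIGHTED PLAQUETTE SUMS
# (lean-1 GEN-11, ours; part 1 of 5 of the defect specific-heat floor (DVF))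

Venture-side (OURS). Cell `lqcd-flow` (pub-lqcd), unit `pub-lqcd-lean-1-g11`, 2026-08-23.

theory2 item 126 (`Scaling/ExtensiveSpecificHeat*`, tree) proves the extensive variance floor of the
WILSON ACTION under the WILSON MEASURE by Dobrushin–Tirozzi sublattice conditioning (heat-bath
innovations).  theory2 item 132 (`DefectProtocolLaw`, HOME tier) needs the same floor for a DIFFERENT
pair: the DEFECT action `S_D = Σ_{p ∈ D} (N − Re tr ρ(U_p))` under the two-coupling family
`∝ exp(−β S_{Dᶜ} − u S_D) dU` — its typed conjecture (DVF) `DefectVarianceFloor`.  This series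
(`TiltedHeatBath` → `TiltedInnovations` → `PlaquetteSumStaple` → `PlaquetteSparseFamily` →
`DefectVarianceFloor`) re-derives item 126's mechanism for an ARBITRARY continuous log-density `Φ`
and an ARBITRARY continuous observable `F` on the configuration space `G^E` of the torus, and then
specialises to weighted plaquette sums.

This part (definitions and the operator identities):
* §1 `haarTilt Φ = e^{Φ} dU / ∫ e^{Φ} dU` (`(Measure.pi Haar).tilted Φ`), a probability measure for
  continuous `Φ`; `integral_haarTilt` (`∫ f dπ_Φ = ∫ e^{Φ} f dU / ∫ e^{Φ} dU`).
* §2 the one-link heat-bath operator `K_e^Φ f = A_e(f e^{Φ}) / A_e(e^{Φ})` (`hbT`; `A_e` = item 126's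
  one-link Haar average `linkAvg`): fibre invariance, continuity, **ORTHOGONALITY**
  `∫ (f − K_e^Φ f) g dπ_Φ = 0` for `g` not depending on the link `e` (`integral_sub_hbT_mul_eq_zero`),
  and the **SHIFT RULE** (`hbT_eq_add`): if along the whole `e`-fibre `Φ` shifts by a constant and `f`
  shifts by `δ`, then `K_e^Φ f` shifts by `δ`.
* §3 the objects of the sequels: the innovation `D_e^Φ F = F − K_e^Φ F` (`innovT`), the Haar fibre
  variance `Q_e F` (`sqDevT`) of an arbitrary observable `F`, and the weighted plaquette sum
  `P_a = Σ_p a_p Re tr ρ(U_p)` (`plaqSum`).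

NOT CLAIMED: anything about a specific action (sequels).  Literature grade (cell rule): known
mechanism (R. Holley, CMP 36 (1974) 227 — domination by bounded conditional densities; Dobrushin–
Tirozzi, CMP 54 (1977) 173 — sublattice conditioning); new typing only, no new theorem of physics.
-/

noncomputable section

namespace Summit.Ventures.LatticeQCDFlow.Theory2.DefectFloor

open MeasureTheory ProbabilityTheory Literature.MathematicalPhysics.QuantumFieldTheory
open Summit.Ventures.LatticeQCDFlow.TrivializingMaps
open Summit.Ventures.LatticeQCDFlow.Theory2.ExtensiveSpecificHeat
open scoped ENNReal

/-! ## §1 The tilted product-Haar measure `π_Φ` -/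

section Tilted

variable {d L : ℕ} [NeZero L] {G : Type*} [Group G] [TopologicalSpace G] [IsTopologicalGroup G]
  [CompactSpace G] [MeasurableSpace G] [BorelSpace G] [SecondCountableTopology G]

/-- **The tilted product-Haar measure** `π_Φ = e^{Φ(U)} dU / ∫ e^{Φ} dU` on the links of the torus
(`dU = ⊗_links Haar`).  `Φ = −β S_W` gives the Wilson measure; `Φ = −(β S_{Dᶜ} + u S_D)` the defect
family of theory2 item 132. -/
def haarTilt (Φ : GaugeConfig d L G → ℝ) : Measure (GaugeConfig d L G) :=
  (Measure.pi fun _ : Edge d L => haarProbability G).tilted Φ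

/-- The tilting weight `e^{Φ}`. -/
def tiltW (Φ : GaugeConfig d L G → ℝ) (U : GaugeConfig d L G) : ℝ := Real.exp (Φ U)

omit [NeZero L] [Group G] [TopologicalSpace G] [IsTopologicalGroup G] [CompactSpace G]
  [MeasurableSpace G] [BorelSpace G] [SecondCountableTopology G] in
/-- `e^{Φ} > 0`. [folklore] -/
theorem tiltW_pos (Φ : GaugeConfig d L G → ℝ) (U : GaugeConfig d L G) : 0 < tiltW Φ U :=
  Real.exp_pos _

omit [NeZero L] [Group G] [IsTopologicalGroup G] [CompactSpace G] [MeasurableSpace G]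
  [BorelSpace G] [SecondCountableTopology G] in
/-- `e^{Φ}` is continuous. [folklore] -/
theorem continuous_tiltW {Φ : GaugeConfig d L G → ℝ} (hΦ : Continuous Φ) : Continuous (tiltW Φ) :=
  Real.continuous_exp.comp hΦ

/-- `∫ e^{Φ} dU > 0`. [folklore] -/
theorem integral_tiltW_pos {Φ : GaugeConfig d L G → ℝ} (hΦ : Continuous Φ) :
    0 < ∫ U, tiltW Φ U ∂Measure.pi fun _ : Edge d L => haarProbability G := by
  unfold tiltW
  exact integral_exp_pos (integrable_of_continuous_config (Real.continuous_exp.comp hΦ))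

/-- `π_Φ` is a probability measure (continuous `Φ` on the compact configuration space). -/
theorem isProbabilityMeasure_haarTilt {Φ : GaugeConfig d L G → ℝ} (hΦ : Continuous Φ) :
    IsProbabilityMeasure (haarTilt Φ) :=
  isProbabilityMeasure_tilted (integrable_of_continuous_config (Real.continuous_exp.comp hΦ))

omit [SecondCountableTopology G] in
/-- **Integrals against `π_Φ`**: `∫ f dπ_Φ = (∫ e^{Φ} f dU) / ∫ e^{Φ} dU`. [folklore] -/
theorem integral_haarTilt (Φ : GaugeConfig d L G → ℝ) (f : GaugeConfig d L G → ℝ) :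
    ∫ U, f U ∂haarTilt Φ
      = (∫ U, tiltW Φ U * f U ∂Measure.pi fun _ : Edge d L => haarProbability G)
          / ∫ U, tiltW Φ U ∂Measure.pi fun _ : Edge d L => haarProbability G := by
  unfold haarTilt tiltW
  rw [integral_tilted]
  simp only [smul_eq_mul]
  have : ∀ U : GaugeConfig d L G,
      Real.exp (Φ U) / (∫ V, Real.exp (Φ V) ∂Measure.pi fun _ : Edge d L => haarProbability G) * f U
        = (Real.exp (Φ U) * f U)
            / ∫ V, Real.exp (Φ V) ∂Measure.pi fun _ : Edge d L => haarProbability G :=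
    fun U => by ring
  simp_rw [this]
  rw [integral_div]

/-- Monotonicity transfer: an inequality between the un-normalised integrals gives the same
inequality between `π_Φ`-integrals. [folklore] -/
theorem integral_haarTilt_le_of_weighted {Φ : GaugeConfig d L G → ℝ} (hΦ : Continuous Φ)
    {f g : GaugeConfig d L G → ℝ} {c : ℝ}
    (h : c * ∫ U, tiltW Φ U * f U ∂(Measure.pi fun _ : Edge d L => haarProbability G)
      ≤ ∫ U, tiltW Φ U * g U ∂(Measure.pi fun _ : Edge d L => haarProbability G)) :
    c * ∫ U, f U ∂haarTilt Φ ≤ ∫ U, g U ∂haarTilt Φ := by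
  rw [integral_haarTilt, integral_haarTilt, ← mul_div_assoc]
  exact div_le_div_of_nonneg_right h (integral_tiltW_pos hΦ).le

end Tilted

/-! ## §2 The one-link heat-bath operator `K_e^Φ` -/

section HeatBath

variable {d L : ℕ} [NeZero L] {G : Type*} [Group G] [TopologicalSpace G] [IsTopologicalGroup G]
  [CompactSpace G] [MeasurableSpace G] [BorelSpace G] [SecondCountableTopology G]
  [DecidableEq (Edge d L)]

/-- **The one-link heat-bath operator** of `π_Φ` at the link `e`:
`K_e^Φ f (U) = ∫ f(h ·ₑ U) e^{Φ(h ·ₑ U)} dh / ∫ e^{Φ(h ·ₑ U)} dh` — the conditional expectation of `f`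
given all links but `e`. -/
def hbT (Φ : GaugeConfig d L G → ℝ) (e : Edge d L) (f : GaugeConfig d L G → ℝ)
    (U : GaugeConfig d L G) : ℝ :=
  linkAvg e (fun V => f V * tiltW Φ V) U / linkAvg e (tiltW Φ) U

/-- `A_e e^{Φ} > 0`. [folklore] -/
theorem linkAvg_tiltW_pos {Φ : GaugeConfig d L G → ℝ} (hΦ : Continuous Φ) (e : Edge d L)
    (U : GaugeConfig d L G) : 0 < linkAvg e (tiltW Φ) U := by
  unfold linkAvg tiltW
  have hc : Continuous fun h : G => Φ (Pi.mulSingle e h * U) :=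
    hΦ.comp (continuous_mulSingle_mul e U)
  exact integral_exp_pos (integrable_of_continuous_group (Real.continuous_exp.comp hc))

/-- `K_e^Φ f` does not depend on the link `e`. [folklore] -/
theorem hbT_mulSingle (Φ : GaugeConfig d L G → ℝ) (e : Edge d L) (f : GaugeConfig d L G → ℝ)
    (h : G) (U : GaugeConfig d L G) : hbT Φ e f (Pi.mulSingle e h * U) = hbT Φ e f U := by
  unfold hbT
  rw [linkAvg_mulSingle, linkAvg_mulSingle]

/-- `K_e^Φ f` is continuous for continuous `Φ, f`. [folklore] -/
theorem continuous_hbT {Φ : GaugeConfig d L G → ℝ} (hΦ : Continuous Φ) (e : Edge d L)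
    {f : GaugeConfig d L G → ℝ} (hf : Continuous f) : Continuous (hbT Φ e f) :=
  (continuous_linkAvg e (hf.mul (continuous_tiltW hΦ))).div
    (continuous_linkAvg e (continuous_tiltW hΦ)) fun U => (linkAvg_tiltW_pos hΦ e U).ne'

/-- **ORTHOGONALITY of the heat-bath innovation.** For continuous `f, g` with `g` not depending on
the link `e`: `∫ (f − K_e^Φ f) · g dπ_Φ = 0`. -/
theorem integral_sub_hbT_mul_eq_zero {Φ : GaugeConfig d L G → ℝ} (hΦ : Continuous Φ) (e : Edge d L)
    {f g : GaugeConfig d L G → ℝ} (hf : Continuous f) (hg : Continuous g)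
    (hginv : ∀ (h : G) (U : GaugeConfig d L G), g (Pi.mulSingle e h * U) = g U) :
    ∫ U, (f U - hbT Φ e f U) * g U ∂haarTilt Φ = 0 := by
  rw [integral_haarTilt]
  refine div_eq_zero_iff.2 (Or.inl ?_)
  have hw : Continuous (tiltW (d := d) (L := L) Φ) := continuous_tiltW hΦ
  have hK : Continuous (hbT Φ e f) := continuous_hbT hΦ e hf
  have h1 : ∫ U, tiltW Φ U * (f U * g U) ∂Measure.pi (fun _ : Edge d L => haarProbability G)
      = ∫ U, g U * linkAvg e (fun V => f V * tiltW Φ V) U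
          ∂Measure.pi (fun _ : Edge d L => haarProbability G) := by
    rw [← integral_linkAvg e (f := fun V => tiltW Φ V * (f V * g V)) (hw.mul (hf.mul hg))]
    refine integral_congr_ae (ae_of_all _ fun U => ?_)
    have : (fun V : GaugeConfig d L G => tiltW Φ V * (f V * g V))
        = fun V => g V * (f V * tiltW Φ V) := by
      funext V; ring
    rw [this, linkAvg_mul_left e hginv]
  have h2 : ∫ U, tiltW Φ U * (hbT Φ e f U * g U) ∂Measure.pi (fun _ : Edge d L => haarProbability G)
      = ∫ U, g U * linkAvg e (fun V => f V * tiltW Φ V) U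
          ∂Measure.pi (fun _ : Edge d L => haarProbability G) := by
    rw [← integral_linkAvg e (f := fun V => tiltW Φ V * (hbT Φ e f V * g V))
      (hw.mul (hK.mul hg))]
    refine integral_congr_ae (ae_of_all _ fun U => ?_)
    have hinv' : ∀ (h : G) (V : GaugeConfig d L G),
        hbT Φ e f (Pi.mulSingle e h * V) * g (Pi.mulSingle e h * V) = hbT Φ e f V * g V := by
      intro h V
      rw [hbT_mulSingle, hginv]
    have : (fun V : GaugeConfig d L G => tiltW Φ V * (hbT Φ e f V * g V))
        = fun V => (hbT Φ e f V * g V) * tiltW Φ V := by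
      funext V; ring
    rw [this, linkAvg_mul_left e hinv']
    have hne := (linkAvg_tiltW_pos hΦ e U).ne'
    simp only [hbT]
    field_simp
  have hi1 : Integrable (fun U => tiltW Φ U * (f U * g U))
      (Measure.pi (fun _ : Edge d L => haarProbability G)) :=
    integrable_of_continuous_config (hw.mul (hf.mul hg))
  have hi2 : Integrable (fun U => tiltW Φ U * (hbT Φ e f U * g U))
      (Measure.pi (fun _ : Edge d L => haarProbability G)) :=
    integrable_of_continuous_config (hw.mul (hK.mul hg))
  calc ∫ U, tiltW Φ U * ((f U - hbT Φ e f U) * g U)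
        ∂Measure.pi (fun _ : Edge d L => haarProbability G)
      = ∫ U, (tiltW Φ U * (f U * g U) - tiltW Φ U * (hbT Φ e f U * g U))
          ∂Measure.pi (fun _ : Edge d L => haarProbability G) := by
        refine integral_congr_ae (ae_of_all _ fun U => ?_); simp only; ring
    _ = ∫ U, tiltW Φ U * (f U * g U) ∂Measure.pi (fun _ : Edge d L => haarProbability G)
          - ∫ U, tiltW Φ U * (hbT Φ e f U * g U)
              ∂Measure.pi (fun _ : Edge d L => haarProbability G) := integral_sub hi1 hi2
    _ = 0 := by rw [h1, h2, sub_self]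

/-- **SHIFT RULE.** If, along the whole `e`-fibre, replacing `U` by `V` shifts the log-density `Φ` by
a constant `δ₁` and the observable `f` by a constant `δ₂`, then `K_e^Φ f (V) = K_e^Φ f (U) + δ₂`. -/
theorem hbT_eq_add {Φ : GaugeConfig d L G → ℝ} (hΦ : Continuous Φ) (e : Edge d L)
    {f : GaugeConfig d L G → ℝ} (hf : Continuous f) {U V : GaugeConfig d L G} {δ₁ δ₂ : ℝ}
    (hΦs : ∀ h : G, Φ (Pi.mulSingle e h * V) = Φ (Pi.mulSingle e h * U) + δ₁)
    (hfs : ∀ h : G, f (Pi.mulSingle e h * V) = f (Pi.mulSingle e h * U) + δ₂) :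
    hbT Φ e f V = hbT Φ e f U + δ₂ := by
  unfold hbT linkAvg tiltW
  simp_rw [hΦs, hfs]
  set S : G → ℝ := fun h => f (Pi.mulSingle e h * U) with hSdef
  set P : G → ℝ := fun h => Φ (Pi.mulSingle e h * U) with hPdef
  have hSc : Continuous S := hf.comp (continuous_mulSingle_mul e U)
  have hPc : Continuous P := hΦ.comp (continuous_mulSingle_mul e U)
  have hwc : Continuous fun h => Real.exp (P h) := Real.continuous_exp.comp hPc
  have hexp : ∀ h, Real.exp (P h + δ₁) = Real.exp δ₁ * Real.exp (P h) := by
    intro h; rw [Real.exp_add]; ring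
  simp_rw [show ∀ h, f (Pi.mulSingle e h * U) = S h from fun h => rfl,
    show ∀ h, Φ (Pi.mulSingle e h * U) = P h from fun h => rfl, hexp]
  have hI1 : Integrable (fun h => Real.exp (P h)) (haarProbability G) :=
    integrable_of_continuous_group hwc
  have hI2 : Integrable (fun h => S h * Real.exp (P h)) (haarProbability G) :=
    integrable_of_continuous_group (hSc.mul hwc)
  have hpos : 0 < ∫ h, Real.exp (P h) ∂haarProbability G := integral_exp_pos hI1
  have hc : 0 < Real.exp δ₁ := Real.exp_pos _
  have hnum : ∫ h, (S h + δ₂) * (Real.exp δ₁ * Real.exp (P h)) ∂haarProbability G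
      = Real.exp δ₁ * (∫ h, S h * Real.exp (P h) ∂haarProbability G
          + δ₂ * ∫ h, Real.exp (P h) ∂haarProbability G) := by
    have : (fun h => (S h + δ₂) * (Real.exp δ₁ * Real.exp (P h)))
        = fun h => Real.exp δ₁ * (S h * Real.exp (P h))
            + (Real.exp δ₁ * δ₂) * Real.exp (P h) := by
      funext h; ring
    rw [this, integral_add (hI2.const_mul _) (hI1.const_mul _), integral_const_mul,
      integral_const_mul]
    ring
  rw [hnum, integral_const_mul, mul_div_mul_left _ _ hc.ne', add_div, mul_div_assoc,
    div_self hpos.ne', mul_one]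

end HeatBath

/-! ## §3 Innovations, fibre variances and weighted plaquette sums (definitions) -/

section Defs

variable {d L N : ℕ} [NeZero L] {G : Type*} [Group G] [TopologicalSpace G] [IsTopologicalGroup G]
  [CompactSpace G] [MeasurableSpace G] [BorelSpace G] [SecondCountableTopology G]
  [DecidableEq (Edge d L)]

/-- **The heat-bath innovation** of the observable `F` at the link `e` under `π_Φ`:
`D_e^Φ F := F − K_e^Φ F`. -/
def innovT (Φ : GaugeConfig d L G → ℝ) (e : Edge d L) (F : GaugeConfig d L G → ℝ)
    (U : GaugeConfig d L G) : ℝ :=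
  F U - hbT Φ e F U

/-- The innovation is continuous. [folklore] -/
theorem continuous_innovT {Φ : GaugeConfig d L G → ℝ} (hΦ : Continuous Φ) (e : Edge d L)
    {F : GaugeConfig d L G → ℝ} (hF : Continuous F) : Continuous (innovT Φ e F) :=
  hF.sub (continuous_hbT hΦ e hF)

/-- `D_e^Φ F` changes along the `e`-fibre exactly as `F` does (`K_e^Φ F` is fibre-constant). -/
theorem innovT_mulSingle_sub (Φ : GaugeConfig d L G → ℝ) (e : Edge d L)
    (F : GaugeConfig d L G → ℝ) (h : G) (U : GaugeConfig d L G) :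
    innovT Φ e F (Pi.mulSingle e h * U) - innovT Φ e F U = F (Pi.mulSingle e h * U) - F U := by
  simp only [innovT, hbT_mulSingle]
  ring

/-- **The fibre variance** of the observable `F` at the link `e`:
`Q_e F (U) = ∫ (F(h ·ₑ U) − A_e F(U))² dh`, the variance of `F` along the `e`-fibre under HAAR
resampling of the link. -/
def sqDevT (e : Edge d L) (F : GaugeConfig d L G → ℝ) (U : GaugeConfig d L G) : ℝ :=
  ∫ h, (F (Pi.mulSingle e h * U) - linkAvg e F U) ^ 2 ∂haarProbability G

/-- `Q_e F` as a one-link Haar average. [folklore] -/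
theorem sqDevT_eq_linkAvg (e : Edge d L) (F : GaugeConfig d L G → ℝ) :
    sqDevT e F = linkAvg e (fun V => (F V - linkAvg e F V) ^ 2) := by
  funext U
  show _ = ∫ h, (F (Pi.mulSingle e h * U) - linkAvg e F (Pi.mulSingle e h * U)) ^ 2
    ∂haarProbability G
  simp only [linkAvg_mulSingle]
  rfl

omit [NeZero L] [SecondCountableTopology G] in
/-- `Q_e F ≥ 0`. [folklore] -/
theorem sqDevT_nonneg (e : Edge d L) (F : GaugeConfig d L G → ℝ) (U : GaugeConfig d L G) :
    0 ≤ sqDevT e F U :=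
  integral_nonneg fun _ => sq_nonneg _

/-- `Q_e F` is continuous for continuous `F`. [folklore] -/
theorem continuous_sqDevT (e : Edge d L) {F : GaugeConfig d L G → ℝ} (hF : Continuous F) :
    Continuous (sqDevT (G := G) e F) := by
  rw [sqDevT_eq_linkAvg]
  exact continuous_linkAvg e ((hF.sub (continuous_linkAvg e hF)).pow 2)

variable (ρ : G →* Matrix (Fin N) (Fin N) ℂ)

/-- **Weighted plaquette sum** `P_a(U) = Σ_p a_p · Re tr ρ(U_p)`.  The Wilson action is
`N·#plaq − P_1`, the defect action of item 132 is `N·#D − P_{1_D}`, and the two-coupling log-density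
`−(β S_{Dᶜ} + u S_D)` is `P_c + const` with `c = β·1_{Dᶜ} + u·1_D`. -/
def plaqSum (a : Plaquette d L → ℝ) (U : GaugeConfig d L G) : ℝ :=
  ∑ p : Plaquette d L, a p * WilsonRP.plaqRe ρ U p

omit [CompactSpace G] [MeasurableSpace G] [BorelSpace G] [SecondCountableTopology G]
  [DecidableEq (Edge d L)] in
/-- A weighted plaquette sum is continuous (continuous `ρ`). [folklore] -/
theorem continuous_plaqSum (hρ : Continuous ρ) (a : Plaquette d L → ℝ) :
    Continuous (plaqSum (d := d) (L := L) ρ a) := by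
  unfold plaqSum
  refine continuous_finsetSum _ fun p _ => continuous_const.mul ?_
  have h1 : Continuous fun U : GaugeConfig d L G => plaquetteHolonomy U p.1 p.2.1.1 p.2.1.2 := by
    unfold plaquetteHolonomy; fun_prop
  exact Complex.continuous_re.comp (hρ.comp h1).matrix_trace

end Defs


end Summit.Ventures.LatticeQCDFlow.Theory2.DefectFloor
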